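import Literature.Combinatorics.Optimization.NonnegativePolynomialConeExtensionDegree
import Mathlib.Analysis.LocallyConvex.Separation
import HarnessLib

/-!
# Moment cones are dual to nonnegativity cones; the moment-matrix LMI (Averkov 2019, Lemma 32; Cor. 15 in the Hilbert cases)

G. Averkov, *Optimal size of linear matrix inequalities in semidefinite approaches to polynomial
optimization*, SIAM J. Appl. Algebra Geom. **3** (2019) 128–151 = arXiv:1806.08656 [cite: Averkov2019]
(held text `paper:arxiv-1806.08656`, arXiv page numbering), verbatim:

* p13: "Moment cones are known to be dual to cones of non-negative polynomials:
  **Lemma 32 (Folklore).** `P_{n,2d}(X)^* = M_{n,2d}(X)` for every `X ⊆ ℝⁿ`. In particular,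
  `P_{n,2d}^* = M_{n,2d}`." (`M_{n,2d}(X) := cl(cone({v_{n,2d}(x) : x ∈ X}))`, p06.)
* p06: "**Corollary 15.** `sxd(M_{n,2d}) = sxc(M_{n,2d}) = ∞` if `n, d ≥ 2, (n,d) ≠ (2,2)`;
  `binom(n+d, n)` otherwise." — proof p13: "Corollaries 14 and 15 are obtained through straightforward
  dualization."

This file PROVES, in the vocabulary of `SosConeSemidefiniteExtensionDegree.lean` (`momentCone n D X`,
`SosCone.momentVector`, `SosCone.coeffVec`/`ofVec`, `sosPolynomialCone`, `nonnegPolynomialCone`,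
`HasBlockPsdLift`, `HasPsdLift`; the tree had only the inclusion `P ⊆ M^*` of Lemma 32,
`dotProduct_coeffVec_nonneg_of_mem_momentCone`):

* **Lemma 32 in full** — `mem_momentCone_iff_forall_nonneg` / `momentCone_eq_dual`: in coefficient
  coordinates, `y ∈ M_{n,D}(X) ⟺ ⟨y, f⟩ ≥ 0` for all `f ∈ P_{n,D}(X)`, for EVERY `X` and degree bound `D`
  (`⊇` by separating a point from the closed convex cone `M` — Mathlib's geometric Hahn–Banach — the
  separating functional being a polynomial nonnegative on `X`).
* **The moment matrix** `SosCone.momentMatrix n d y = (y_{α+β})_{|α|,|β| ≤ d}` (rows/columns indexed by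
  the monomials of degree `≤ d`), `M_d(v_{2d}(x)) = v_d(x) v_d(x)ᵀ`, the square identity
  `⟨y, q²⟩ = cᵀ M_d(y) c` (`dotProduct_coeffVec_ofVec_sq`) and hence **the dual of `Σ_{n,2d}` is the LMI
  `M_d(y) ⪰ 0`** (`forall_sos_dotProduct_nonneg_iff_posSemidef`); consequently moment matrices are psd on
  every `M_{n,2d}(X)` (`posSemidef_momentMatrix_of_mem_momentCone`) and, by Lemma 32, **in a Hilbert case
  `Σ_{n,2d} = P_{n,2d}` one has `M_{n,2d} = {y : M_d(y) ⪰ 0}`** (`momentCone_eq_setOf_posSemidef_of_sos_eq`).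
* **Corollary 15 in the Hilbert cases**: the LMI set `{y : M_d(y) ⪰ 0}` is an `S^{binom(n+d,n)}_+`-lifted
  set (`SosCone.hasBlockPsdLift_setOf_posSemidef_momentMatrix`, via a linear left inverse
  `SosCone.ofMomentMatrix` of the injective moment-matrix map), so `sxd(M_{n,2d}) = sxc(M_{n,2d}) =
  binom(n+d,n)` whenever `Σ_{n,2d} = P_{n,2d}` (`isLeast_blockSize_hasBlockPsdLift_momentCone_of_sos_eq`,
  `isLeast_size_hasPsdLift_momentCone_of_sos_eq`; the lower bound is the tree's Corollary 14). With the
  tree's Hilbert cases (`NonnegativePolynomialConeExtensionDegree.lean`): **`n = 1`, every `d`: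
  `sxd(M_{1,2d}) = sxc(M_{1,2d}) = d + 1`** (`isLeast_blockSize_hasBlockPsdLift_momentCone_univariate`,
  `isLeast_size_hasPsdLift_momentCone_univariate`; the univariate closed moment cone IS the cone of psd
  Hankel matrices, `mem_momentCone_univariate_iff_posSemidef`), and `d = 1`, every `n`, re-derived by
  duality (`isLeast_blockSize_hasBlockPsdLift_momentCone_two_of_duality`; the explicit identification
  `M_{n,2} ≅ S^{n+1}_+` is `MomentConeDegreeTwo.lean`).

NOT here: the case `(n,d) = (2,2)` (needs `P_{2,4} = Σ_{2,4}`, ternary quartics, not in the tree) and the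
infinite cases (Scheiderer's Theorem 13); the abstract duality `sxd(C^*) = sxd(C)` (2.2). Everything here
is proved; no named fact.
-/

noncomputable section

open Finset Matrix MvPolynomial
open scoped MatrixOrder

namespace Literature.Combinatorics.Optimization

open SosCone

/-! ### §1 Lemma 32: `M_{n,D}(X) = P_{n,D}(X)^*` -/

/-- A continuous linear functional on `ι → ℝ` is a scalar product. [folklore] -/
private theorem exists_eq_dotProduct {ι : Type*} [Fintype ι] [DecidableEq ι] (φ : StrongDual ℝ (ι → ℝ)) :
    ∃ a : ι → ℝ, ∀ y, φ y = y ⬝ᵥ a := by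
  refine ⟨fun i => φ (fun j => if i = j then 1 else 0), fun y => ?_⟩
  have h := LinearMap.pi_apply_eq_sum_univ (φ : (ι → ℝ) →ₗ[ℝ] ℝ) y
  rw [ContinuousLinearMap.coe_coe] at h
  rw [h, dotProduct]
  exact sum_congr rfl fun i _ => by rw [smul_eq_mul]

/-- **Averkov 2019, Lemma 32 (folklore): `P_{n,D}(X)^* = M_{n,D}(X)`** — in coefficient coordinates, a
vector `y` lies in the (closed) moment cone `M_{n,D}(X) = cl cone{v_{n,D}(x) : x ∈ X}` iff `⟨y, f⟩ ≥ 0` for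
every `f ∈ ℝ[x]_D` nonnegative on `X`. (`⊆` is `dotProduct_coeffVec_nonneg_of_mem_momentCone`; `⊇`: if
`y ∉ M`, separate `y` from the closed convex cone `M` by a linear functional `⟨·, a⟩ ≥ 0` on `M` with
`⟨y, a⟩ < 0` — then `f = Σ a_α x^α` is nonnegative on `X`, `f(x) = ⟨v(x), a⟩`, and `⟨y, f⟩ < 0`.) Holds
for every `X ⊆ ℝⁿ` and every degree bound `D`. [cite: Averkov2019, Lemma 32 (p13)] -/
theorem mem_momentCone_iff_forall_nonneg {n D : ℕ} (X : Set (Fin n → ℝ)) (y : Idx n D → ℝ) :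
    y ∈ momentCone n D X ↔ ∀ f ∈ nonnegPolynomialCone n D X, 0 ≤ y ⬝ᵥ coeffVec n D f := by
  classical
  refine ⟨fun hy f hf => dotProduct_coeffVec_nonneg_of_mem_momentCone hf hy, fun h => ?_⟩
  by_contra hyM
  have hconv : Convex ℝ (momentCone n D X) := (PointedCone.convex _).closure
  obtain ⟨φ, u, hφ, hu⟩ := geometric_hahn_banach_closed_point hconv isClosed_closure hyM
  obtain ⟨a, ha⟩ := exists_eq_dotProduct φ
  -- `φ ≤ 0` on the cone (scale), `φ 0 = 0 < u < φ y`
  have h0 : 0 < u := by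
    have := hφ 0 (subset_closure (Submodule.zero_mem _))
    rwa [map_zero] at this
  have hneg : ∀ m ∈ momentCone n D X, φ m ≤ 0 := by
    intro m hm
    by_contra hpos
    replace hpos : 0 < φ m := not_le.1 hpos
    -- `t • m ∈ M` with `φ (t • m) = t φ m > u` for `t` large
    have ht := hφ ((u / φ m + 1) • m) (smul_mem_momentCone hm (by positivity))
    rw [map_smul, smul_eq_mul, add_mul, div_mul_cancel₀ _ hpos.ne', one_mul] at ht
    linarith
  -- the polynomial `f = Σ (−a_α) x^α` is nonnegative on `X`
  set f := ofVec n D (-a) with hf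
  have hfP : f ∈ nonnegPolynomialCone n D X := by
    refine ⟨totalDegree_ofVec_le _, fun x hx => ?_⟩
    rw [hf, eval_ofVec, dotProduct_neg, ← ha]
    exact neg_nonneg.2 (hneg _ (momentVector_mem_momentCone hx))
  have h1 := h f hfP
  rw [hf, coeffVec_ofVec, dotProduct_neg, ← ha] at h1
  linarith

/-- Lemma 32 as an equality of sets. [cite: Averkov2019, Lemma 32 (p13)] -/
theorem momentCone_eq_dual (n D : ℕ) (X : Set (Fin n → ℝ)) :
    momentCone n D X = {y | ∀ f ∈ nonnegPolynomialCone n D X, 0 ≤ y ⬝ᵥ coeffVec n D f} :=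
  Set.ext fun y => mem_momentCone_iff_forall_nonneg X y

/-! ### §2 The moment matrix `M_d(y)` and the dual of `Σ_{n,2d}` -/

namespace SosCone

variable {n d : ℕ}

/-- Sum of two exponent vectors of degree `≤ d`: an exponent vector of degree `≤ 2d`. [folklore] -/
def Idx.addIdx (α β : Idx n d) : Idx n (2 * d) :=
  ⟨fun i => ⟨(α.1 i : ℕ) + (β.1 i : ℕ), by have := (α.1 i).2; have := (β.1 i).2; omega⟩, by
    have h : ∑ i, ((α.1 i : ℕ) + (β.1 i : ℕ)) = ∑ i, (α.1 i : ℕ) + ∑ i, (β.1 i : ℕ) := sum_add_distrib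
    have hα := α.2; have hβ := β.2
    show ∑ i, ((α.1 i : ℕ) + (β.1 i : ℕ)) ≤ 2 * d
    omega⟩

/-- Components of `addIdx`. [folklore] -/
@[simp] private theorem Idx.addIdx_apply_val (α β : Idx n d) (i : Fin n) :
    ((Idx.addIdx α β).1 i : ℕ) = (α.1 i : ℕ) + (β.1 i : ℕ) := rfl

/-- `addIdx` is commutative. [folklore] -/
private theorem Idx.addIdx_comm (α β : Idx n d) : Idx.addIdx α β = Idx.addIdx β α :=
  Subtype.ext (funext fun i => Fin.ext (by simp [Nat.add_comm]))

/-- `x^α x^β = x^{α+β}` as monomials. [folklore] -/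
private theorem mono_mul_mono (α β : Idx n d) : mono α * mono β = mono (Idx.addIdx α β) := by
  have h : α.toFinsupp + β.toFinsupp = (Idx.addIdx α β).toFinsupp := by
    ext i
    simp [Idx.toFinsupp, Idx.addIdx]
  rw [mono, mono, mono, monomial_mul, one_mul, h]

/-- `v_{2d}(x)_{α+β} = v_d(x)_α v_d(x)_β`. [folklore] -/
private theorem momentVector_addIdx (x : Fin n → ℝ) (α β : Idx n d) :
    momentVector (2 * d) x (Idx.addIdx α β) = momentVector d x α * momentVector d x β := by
  simp only [momentVector, Idx.addIdx_apply_val, pow_add, prod_mul_distrib]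

/-- The coefficient vector of a monomial is a unit vector. [folklore] -/
private theorem coeffVec_mono {D : ℕ} (δ : Idx n D) : coeffVec n D (mono δ) = Pi.single δ 1 := by
  classical
  funext γ
  rw [coeffVec_apply, mono, coeff_monomial]
  by_cases h : γ = δ
  · subst h; simp
  · rw [if_neg, Pi.single_eq_of_ne h]
    intro hδγ
    apply h
    -- `toFinsupp` is injective
    apply Subtype.ext; funext i; apply Fin.ext
    have := DFunLike.congr_fun hδγ i
    simpa [Idx.toFinsupp] using this.symm

/-- **The moment matrix** `M_d(y)_{αβ} = y_{α+β}` of a (pseudo-)moment vector `y ∈ ℝ^{binom(n+2d,n)}`,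
rows and columns indexed by the monomials of degree `≤ d`. [cite: Averkov2019, (1.1) (p03) and Lemma 32 (p13)] -/
def momentMatrix (n d : ℕ) : (Idx n (2 * d) → ℝ) →ₗ[ℝ] Matrix (Idx n d) (Idx n d) ℝ where
  toFun y := Matrix.of fun α β => y (Idx.addIdx α β)
  map_add' y z := by ext α β; rfl
  map_smul' c y := by ext α β; rfl

/-- Entries of the moment matrix. [cite: Averkov2019, (1.1) (p03)] -/
@[simp] theorem momentMatrix_apply (y : Idx n (2 * d) → ℝ) (α β : Idx n d) :
    momentMatrix n d y α β = y (Idx.addIdx α β) := rfl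

/-- The moment matrix is symmetric. [cite: Averkov2019, (1.1) (p03)] -/
theorem momentMatrix_isSymm (y : Idx n (2 * d) → ℝ) : (momentMatrix n d y).IsSymm := by
  ext α β
  rw [transpose_apply, momentMatrix_apply, momentMatrix_apply, Idx.addIdx_comm]

/-- **`M_d(v_{2d}(x)) = v_d(x) v_d(x)ᵀ`**: moment matrices of points are rank one and psd.
[cite: Averkov2019, (1.1) (p03)] -/
theorem momentMatrix_momentVector (x : Fin n → ℝ) :
    momentMatrix n d (momentVector (2 * d) x) = vecMulVec (momentVector d x) (momentVector d x) := by
  ext α β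
  rw [momentMatrix_apply, momentVector_addIdx, vecMulVec_apply]

/-- **The square identity `⟨y, q²⟩ = cᵀ M_d(y) c`** for `q = Σ_α c_α x^α ∈ ℝ[x]_d` (the pairing of a
pseudo-moment vector with a square is the quadratic form of its moment matrix).
[cite: Averkov2019, (1.1) (p03) with Lemma 32 (p13)] -/
theorem dotProduct_coeffVec_ofVec_sq (y : Idx n (2 * d) → ℝ) (c : Idx n d → ℝ) :
    y ⬝ᵥ coeffVec n (2 * d) (ofVec n d c ^ 2) = c ⬝ᵥ momentMatrix n d y *ᵥ c := by
  classical
  have hq : ofVec n d c = ∑ α, c α • mono α := by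
    rw [ofVec_apply]
    exact sum_congr rfl fun α _ => by rw [mono, smul_monomial, smul_eq_mul, mul_one]
  have hsq : ofVec n d c ^ 2 = ∑ α, ∑ β, (c α * c β) • mono (Idx.addIdx α β) := by
    rw [sq, hq, sum_mul_sum]
    refine sum_congr rfl fun α _ => sum_congr rfl fun β _ => ?_
    rw [smul_mul_smul_comm, mono_mul_mono]
  rw [hsq, map_sum, dotProduct_sum]
  simp only [map_sum, map_smul, coeffVec_mono, dotProduct_sum, dotProduct_smul, dotProduct_single,
    mul_one, smul_eq_mul]
  -- right-hand side
  simp only [dotProduct, mulVec, momentMatrix_apply, mul_sum]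
  exact sum_congr rfl fun α _ => sum_congr rfl fun β _ => by ring

/-- **The dual of `Σ_{n,2d}` is the moment-matrix LMI**: `⟨y, s⟩ ≥ 0` for all `s ∈ Σ_{n,2d}` iff
`M_d(y) ⪰ 0`. [cite: Averkov2019, (1.1) (p03) with Lemma 32 (p13)] -/
theorem forall_sos_dotProduct_nonneg_iff_posSemidef (y : Idx n (2 * d) → ℝ) :
    (∀ s ∈ sosPolynomialCone n d, 0 ≤ y ⬝ᵥ coeffVec n (2 * d) s) ↔ (momentMatrix n d y).PosSemidef := by
  constructor
  · intro h
    refine PosSemidef.of_dotProduct_mulVec_nonneg ?_ fun c => ?_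
    · rw [IsHermitian, conjTranspose_eq_transpose_of_trivial]
      exact momentMatrix_isSymm y
    · rw [star_trivial, ← dotProduct_coeffVec_ofVec_sq]
      exact h _ (sq_mem_sosPolynomialCone _ (totalDegree_ofVec_le c))
  · intro hM s hs
    obtain ⟨r, q, hqd, rfl⟩ := exists_eq_sum_sq_of_mem_sosPolynomialCone hs
    rw [map_sum, dotProduct_sum]
    refine sum_nonneg fun j _ => ?_
    rw [← ofVec_coeffVec (hqd j), dotProduct_coeffVec_ofVec_sq]
    have := hM.dotProduct_mulVec_nonneg (coeffVec n d (q j))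
    rwa [star_trivial] at this

end SosCone

/-! ### §3 Consequences: moment matrices on `M_{n,2d}(X)`, and `M_{n,2d} = {M_d(y) ⪰ 0}` in the Hilbert cases -/

/-- **Moment matrices of the elements of `M_{n,2d}(X)` are positive semidefinite** (for every `X`):
`M_{n,2d}(X) ⊆ P_{n,2d}(X)^* ⊆ Σ_{n,2d}^* = {y : M_d(y) ⪰ 0}`. [cite: Averkov2019, Lemma 32 (p13) with (1.1) (p03)] -/
theorem posSemidef_momentMatrix_of_mem_momentCone {n d : ℕ} {X : Set (Fin n → ℝ)} {y : Idx n (2 * d) → ℝ}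
    (hy : y ∈ momentCone n (2 * d) X) : (SosCone.momentMatrix n d y).PosSemidef :=
  (SosCone.forall_sos_dotProduct_nonneg_iff_posSemidef y).1 fun _ hs =>
    dotProduct_coeffVec_nonneg_of_mem_momentCone (sosPolynomialCone_subset_nonnegPolynomialCone n d X hs) hy

/-- **In a Hilbert case `Σ_{n,2d} = P_{n,2d}` the moment cone is ONE linear matrix inequality**:
`M_{n,2d} = {y : M_d(y) ⪰ 0}` (Lemma 32 + the dual of `Σ`). [cite: Averkov2019, Cor. 15 (p06) with Lemma 32 (p13)] -/
theorem momentCone_eq_setOf_posSemidef_of_sos_eq {n d : ℕ}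
    (hH : sosPolynomialCone n d = nonnegPolynomialCone n (2 * d) Set.univ) :
    momentCone n (2 * d) Set.univ = {y | (SosCone.momentMatrix n d y).PosSemidef} := by
  ext y
  rw [mem_momentCone_iff_forall_nonneg, Set.mem_setOf_eq, ← SosCone.forall_sos_dotProduct_nonneg_iff_posSemidef,
    hH]

/-! ### §4 The LMI `{y : M_d(y) ⪰ 0}` is `S^{binom(n+d,n)}_+`-lifted; Corollary 15 in the Hilbert cases -/

namespace SosCone

variable {n d : ℕ}

/-- A chosen splitting `γ = α + β` of an exponent vector of degree `≤ 2d`. [folklore] -/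
private def rep2 (γ : Idx n (2 * d)) : Idx n d × Idx n d :=
  ((Idx.exists_add_eq γ).choose, (Idx.exists_add_eq γ).choose_spec.choose)

/-- The chosen splitting sums to `γ`. [folklore] -/
private theorem addIdx_rep2 (γ : Idx n (2 * d)) : Idx.addIdx (rep2 γ).1 (rep2 γ).2 = γ := by
  have h := (Idx.exists_add_eq γ).choose_spec.choose_spec
  exact Subtype.ext (funext fun i => Fin.ext (h i))

/-- **A linear left inverse of the moment matrix**: read `y_γ` off the entry `(α, β)` of a chosen splitting
`γ = α + β`. [cite: Averkov2019, (1.1) (p03)] -/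
def ofMomentMatrix (n d : ℕ) : Matrix (Idx n d) (Idx n d) ℝ →ₗ[ℝ] (Idx n (2 * d) → ℝ) where
  toFun M γ := M (rep2 γ).1 (rep2 γ).2
  map_add' M N := by funext γ; rfl
  map_smul' c M := by funext γ; rfl

/-- `ofMomentMatrix ∘ M_d = id`. [cite: Averkov2019, (1.1) (p03)] -/
@[simp] theorem ofMomentMatrix_momentMatrix (y : Idx n (2 * d) → ℝ) :
    ofMomentMatrix n d (momentMatrix n d y) = y := by
  funext γ
  show momentMatrix n d y (rep2 γ).1 (rep2 γ).2 = y γ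
  rw [momentMatrix_apply, addIdx_rep2]

/-- **The moment-matrix LMI is a semidefinite extended formulation with one block of size `binom(n+d,n)`**:
`{y : M_d(y) ⪰ 0}` is the image under `ofMomentMatrix` of the section of `S^N_+` (`N = |{α : |α| ≤ d}|`)
by the linear subspace of moment matrices. [cite: Averkov2019, (1.3) (p03) and Cor. 15 (p06)] -/
theorem hasBlockPsdLift_setOf_posSemidef_momentMatrix (n d : ℕ) :
    HasBlockPsdLift {y : Idx n (2 * d) → ℝ | (momentMatrix n d y).PosSemidef} (Fintype.card (Idx n d)) 1 := by
  classical
  set N := Fintype.card (Idx n d) with hN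
  set e := Fintype.equivFin (Idx n d) with he
  let R : Matrix (Idx n d) (Idx n d) ℝ ≃ₗ[ℝ] Matrix (Fin N) (Fin N) ℝ := Matrix.reindexLinearEquiv ℝ ℝ e e
  let Lm : (Idx n (2 * d) → ℝ) →ₗ[ℝ] Matrix (Fin N) (Fin N) ℝ := R.toLinearMap ∘ₗ momentMatrix n d
  let Lb : Matrix (Fin N) (Fin N) ℝ →ₗ[ℝ] (Idx n (2 * d) → ℝ) := ofMomentMatrix n d ∘ₗ R.symm.toLinearMap
  have hLbLm : ∀ y, Lb (Lm y) = y := fun y => by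
    show ofMomentMatrix n d (R.symm (R (momentMatrix n d y))) = y
    rw [LinearEquiv.symm_apply_apply, ofMomentMatrix_momentMatrix]
  have hpsd : ∀ y, (Lm y).PosSemidef ↔ (momentMatrix n d y).PosSemidef := fun y => by
    show (Matrix.reindexLinearEquiv ℝ ℝ e e (momentMatrix n d y)).PosSemidef ↔ _
    rw [Matrix.coe_reindexLinearEquiv, Matrix.reindex_apply]
    exact Matrix.posSemidef_submatrix_equiv e.symm
  have hset : {y : Idx n (2 * d) → ℝ | (momentMatrix n d y).PosSemidef} =
      Lb '' ({B : Matrix (Fin N) (Fin N) ℝ | B.PosSemidef} ∩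
        ((LinearMap.range Lm).toAffineSubspace : Set (Matrix (Fin N) (Fin N) ℝ))) := by
    ext y
    constructor
    · intro hy
      refine ⟨Lm y, ⟨(hpsd y).2 hy, ?_⟩, hLbLm y⟩
      exact LinearMap.mem_range_self Lm y
    · rintro ⟨B, ⟨hB, hBr⟩, rfl⟩
      obtain ⟨y', rfl⟩ : ∃ y', Lm y' = B := hBr
      rw [Set.mem_setOf_eq, hLbLm, ← hpsd]
      exact hB
  rw [hset]
  exact ((SpectraplexNeighborly.hasBlockPsdLift_posSemidef_self N).inter_affineSubspace _).image Lb

end SosCone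

/-- **Corollary 15 in a Hilbert case, upper bound**: if `Σ_{n,2d} = P_{n,2d}` then `M_{n,2d}` has an
`S^{binom(n+d,n)}_+`-lift with one block (the moment-matrix LMI). [cite: Averkov2019, Cor. 15 (p06)] -/
theorem hasBlockPsdLift_momentCone_of_sos_eq {n d : ℕ}
    (hH : sosPolynomialCone n d = nonnegPolynomialCone n (2 * d) Set.univ) :
    HasBlockPsdLift (momentCone n (2 * d) Set.univ) ((n + d).choose n) 1 := by
  rw [momentCone_eq_setOf_posSemidef_of_sos_eq hH, ← card_Idx]
  exact SosCone.hasBlockPsdLift_setOf_posSemidef_momentMatrix n d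

/-- **Averkov 2019, Corollary 15 in the Hilbert cases: `sxd(M_{n,2d}) = binom(n+d, n)` whenever
`Σ_{n,2d} = P_{n,2d}`** (lower bound: Corollary 14, `int ℝⁿ ≠ ∅`; upper bound: the moment-matrix LMI via
Lemma 32). [cite: Averkov2019, Cor. 15 (p06), proof (p13)] -/
theorem isLeast_blockSize_hasBlockPsdLift_momentCone_of_sos_eq {n d : ℕ}
    (hH : sosPolynomialCone n d = nonnegPolynomialCone n (2 * d) Set.univ) :
    IsLeast {k : ℕ | ∃ m : ℕ, HasBlockPsdLift (momentCone n (2 * d) Set.univ) k m} ((n + d).choose n) :=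
  ⟨⟨1, hasBlockPsdLift_momentCone_of_sos_eq hH⟩,
    mem_lowerBounds_blockSize_hasBlockPsdLift_momentCone (by rw [interior_univ]; exact Set.univ_nonempty)⟩

/-- **Corollary 15 in the Hilbert cases, one block: `sxc(M_{n,2d}) = binom(n+d, n)`.**
[cite: Averkov2019, Cor. 15 (p06)] -/
theorem isLeast_size_hasPsdLift_momentCone_of_sos_eq {n d : ℕ}
    (hH : sosPolynomialCone n d = nonnegPolynomialCone n (2 * d) Set.univ) :
    IsLeast {k : ℕ | HasPsdLift (momentCone n (2 * d) Set.univ) k} ((n + d).choose n) := by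
  refine ⟨hasBlockPsdLift_one_iff.1 (hasBlockPsdLift_momentCone_of_sos_eq hH), fun k hk => ?_⟩
  exact (isLeast_blockSize_hasBlockPsdLift_momentCone_of_sos_eq hH).2 ⟨1, hasBlockPsdLift_one_iff.2 hk⟩

/-- **Averkov 2019, Corollary 15, the case `n = 1`: `sxd(M_{1,2d}) = binom(1+d, 1) = d + 1`** — the closed
cone of univariate pseudo-moment vectors of order `2d` (= positive semidefinite Hankel matrices, by
`momentCone_eq_setOf_posSemidef_of_sos_eq` and Hilbert's `Σ_{1,2d} = P_{1,2d}`) needs exactly block size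
`d + 1`. [cite: Averkov2019, Cor. 15 (p06)] -/
theorem isLeast_blockSize_hasBlockPsdLift_momentCone_univariate (d : ℕ) :
    IsLeast {k : ℕ | ∃ m : ℕ, HasBlockPsdLift (momentCone 1 (2 * d) Set.univ) k m} (d + 1) := by
  have h := isLeast_blockSize_hasBlockPsdLift_momentCone_of_sos_eq
    (sosPolynomialCone_univariate_eq_nonnegPolynomialCone d)
  rwa [Nat.choose_one_right, add_comm] at h

/-- **Averkov 2019, Corollary 15, the case `n = 1`, one block: `sxc(M_{1,2d}) = d + 1`** (the Hankel LMI of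
size `d + 1` is optimal). [cite: Averkov2019, Cor. 15 (p06)] -/
theorem isLeast_size_hasPsdLift_momentCone_univariate (d : ℕ) :
    IsLeast {k : ℕ | HasPsdLift (momentCone 1 (2 * d) Set.univ) k} (d + 1) := by
  have h := isLeast_size_hasPsdLift_momentCone_of_sos_eq (sosPolynomialCone_univariate_eq_nonnegPolynomialCone d)
  rwa [Nat.choose_one_right, add_comm] at h

/-- **The univariate closed moment cone is the cone of positive semidefinite Hankel matrices**:
`y ∈ M_{1,2d} ⟺ (y_{i+j})_{i,j ≤ d} ⪰ 0`. [cite: Averkov2019, Cor. 15 (p06) with Lemma 32 (p13)] -/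
theorem mem_momentCone_univariate_iff_posSemidef (d : ℕ) (y : Idx 1 (2 * d) → ℝ) :
    y ∈ momentCone 1 (2 * d) Set.univ ↔ (SosCone.momentMatrix 1 d y).PosSemidef := by
  rw [momentCone_eq_setOf_posSemidef_of_sos_eq (sosPolynomialCone_univariate_eq_nonnegPolynomialCone d),
    Set.mem_setOf_eq]

/-- **Corollary 15, the case `d = 1`, re-derived by duality**: `sxd(M_{n,2}) = binom(n+1,n) = n + 1` (the
explicit identification with `S^{n+1}_+` is in `MomentConeDegreeTwo.lean`). [cite: Averkov2019, Cor. 15 (p06)] -/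
theorem isLeast_blockSize_hasBlockPsdLift_momentCone_two_of_duality (n : ℕ) :
    IsLeast {k : ℕ | ∃ m : ℕ, HasBlockPsdLift (momentCone n (2 * 1) Set.univ) k m} (n + 1) := by
  have h := isLeast_blockSize_hasBlockPsdLift_momentCone_of_sos_eq (sosPolynomialCone_one_eq_nonnegPolynomialCone n)
  rwa [Nat.choose_succ_self_right] at h

end Literature.Combinatorics.Optimization
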